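import Summits.QuantumFields.YangMills.Theorems.VirialFluxGapTreeGaugeGibbsTransfer
import Summits.QuantumFields.YangMills.Theorems.VirialFluxGapPeriodicVolumeFloor
import Summits.QuantumFields.YangMills.Theorems.TwistExponentGapPeriodicToronFloorToronBox
import HarnessLib

/-!
# The TORON BOX of the zero-flux ring in slice-`0` tree gauge: the action deficit is `O_L(t₂²)` on it
# (helper toward the SHARP periodic floor of `TT.physTrace L β (2L)` at every fixed `L`; free-hands support of
# item stmt-QuantumFields-23802 `SwapTwistDeficit.TwistRatioVanishesFixedL`, brick (A) of the fixed-`L` reduction memo of seat w2 g54)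

In the tree-gauge coordinates `x = (w, (r, g)) ∈ X_fix = SU(2)^{off} × (GaugeConfig 3 L SU2)^{2L−1} × SU(2)^{sites}` of a `2L`-slice ring history
`(glue w ∷ r, g)` (✓`VirialFluxGapRingTreeGauge`, ✓`VirialFluxGapTreeGaugeGibbsTransfer`) the TORON BOX of radii `(t₁, t₂)` is: the three LEADER wrap
links `(−ê_μ, μ)` of slice `0` and the seam value `g 0` within `t₁` of `1`; every other off-tree link of slice `0` within `t₂` of its LETTER (`w(−ê_μ, μ)` if
the link crosses the seam `x_μ = −1`, else `1`); every link of the slices `1, …, 2L−1` within `t₂` of the corresponding link of slice `0`; every seam value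
`g x` within `t₂` of `g 0`.  This file proves the ACTION side of the sharp floor:

* §1 (d = 3 twin of ✓`TwistExponentGap.ToronFloor.norm_rho_plaquetteHolonomy_sub_one_le_of_toron`, which is hard-coded on `(ℤ/L)⁴`)
  `frobNorm_plaquetteHolonomy_sub_one_le_of_toronBox` ∕ `wilsonAction_le_of_toronBox`: letters `t₁`-close to `1` and links `t₂`-close to their
  letters force every spatial plaquette within `4t₂ + 2t₁²` of `1`, so `S(V) ≤ 3L³·(4t₂ + 2t₁²)²/2`;
* §2 `kinetic_le_of_dist`, `frobNorm_gaugeTransform_sub_le_of_seamBox` — kinetic bonds and the seam bond on the box;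
* §3 ★ `ringDeficit_le_of_toronBox` — for `0 ≤ t₁ ≤ 1`, `0 ≤ t₂`, `t₁² ≤ t₂`: `F₀(glue w ∷ r, g) ≤ 400·L⁴·t₂²` on the toron box
  (✓`ringDeficit_eq_sums`).

With `t₂ = β^{−1/2}`, `t₁ = β^{−1/4}` the box has product-Haar mass `≍ β^{−3}·β^{−3(6L⁴−3)/2} = β^{−(9L⁴−3/2)}` (next file), the sharp exponent of
the periodic toron valley (`18L⁴ − 3` massive directions), against the crude `12L⁴ + 2L³` of ✓`VirialFluxGapPeriodicVolumeFloor`.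

HONEST FRAMING: fixed-lattice Frobenius-norm bookkeeping ([cite: Luscher1983, §2]; [cite: Vanbaal2001]; [cite: Chatterjee2016, Lemma 9.3]); nothing of
⟨23802⟩ (which also needs a CEILING for the swap-twisted trace), of any crux, rung or summit is proved; the Yang–Mills mass gap is NOT proved; no summit is
proved by a line.  THEOREMS ONLY (0 `def`, 0 `sorry`), standard axioms.  Width seat ym-line-sfw-p2-w3 g61 (cell ym-idea-1, free hands),
`--supports stmt-QuantumFields-23802`.
-/

set_option autoImplicit false

noncomputable section

open MeasureTheory
open scoped BigOperators Matrix.Norms.Frobenius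
open Literature.MathematicalPhysics.QuantumFieldTheory hiding SU2
open Literature.MathematicalPhysics.QuantumLattice
open Summit.QuantumFields.YangMills.Theorems.FemtoTransferGap
open Summit.QuantumFields.YangMills.Theorems.FemtoTransferGap.TT
open Summit.QuantumFields.YangMills.Theorems.VirialFluxGap.RingDeficit
open Summit.QuantumFields.YangMills.Theorems.ToronValleyVolume.Lojasiewicz (ringDeficit_eq_sums)
open Summit.QuantumFields.YangMills.Theorems.TwistExponentGap.ToronFloor (norm_rho_plaquetteWord_sub_one_le norm_rho_commutator_sub_one_le)
open Summit.QuantumFields.YangMills.Theorems.FemtoCurvatureTwoPoint.DoublingOfRV (sub_re_trace_le)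

namespace Summit.QuantumFields.YangMills.Theorems.SwapTwistDeficit.PeriodicRingFloor

variable {L : ℕ} [NeZero L]

/-! ## §0 Frobenius-norm bookkeeping on `SU(2)` -/

/-- The Frobenius distance to `1` read through the fundamental representation. [folklore] -/
theorem norm_su2Rep_sub_one (W : SU2) : ‖su2Rep W - 1‖ = frobNorm ((W : Matrix (Fin 2) (Fin 2) ℂ) - 1) := by
  rw [fundamentalRep_apply, frobNorm_eq_norm]

/-- `‖A⁻¹V − 1‖_F = ‖V − A‖_F` (left unitary invariance). [folklore] -/
theorem frobNorm_inv_mul_sub_one (A V : SU2) :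
    frobNorm (((A⁻¹ * V : SU2) : Matrix (Fin 2) (Fin 2) ℂ) - 1) =
      frobNorm ((V : Matrix (Fin 2) (Fin 2) ℂ) - (A : Matrix (Fin 2) (Fin 2) ℂ)) := by
  have h1 : ((A⁻¹ * V : SU2) : Matrix (Fin 2) (Fin 2) ℂ) - 1 =
      ((A⁻¹ : SU2) : Matrix (Fin 2) (Fin 2) ℂ) * ((V : Matrix (Fin 2) (Fin 2) ℂ) - (A : Matrix (Fin 2) (Fin 2) ℂ)) := by
    rw [Matrix.mul_sub, ← Submonoid.coe_mul, ← Submonoid.coe_mul, inv_mul_cancel]; rfl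
  rw [h1, frobNorm_unitary_mul (su2_mem_unitaryGroup A⁻¹)]

/-- Conjugating by an element `s`-close to `1` moves an element `u`-close to `1` by at most `2su`:
`‖cUc⁻¹ − U‖_F ≤ 2‖c − 1‖_F‖U − 1‖_F`. [folklore] -/
theorem frobNorm_conj_sub_le (c U : SU2) :
    frobNorm (((c * U * c⁻¹ : SU2) : Matrix (Fin 2) (Fin 2) ℂ) - (U : Matrix (Fin 2) (Fin 2) ℂ)) ≤
      2 * (frobNorm ((c : Matrix (Fin 2) (Fin 2) ℂ) - 1) * frobNorm ((U : Matrix (Fin 2) (Fin 2) ℂ) - 1)) := by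
  rw [frobNorm_sub_eq_mul_inv, ← norm_su2Rep_sub_one, ← norm_su2Rep_sub_one, ← norm_su2Rep_sub_one]
  exact norm_rho_commutator_sub_one_le su2Rep su2_mem_unitaryGroup c U

/-- `‖aUb⁻¹ − cUc⁻¹‖_F ≤ ‖a − c‖_F + ‖b − c‖_F` (unitary invariance, one letter at a time). [folklore] -/
theorem frobNorm_sandwich_sub_sandwich_le (a b c U : SU2) :
    frobNorm (((a * U * b⁻¹ : SU2) : Matrix (Fin 2) (Fin 2) ℂ) - ((c * U * c⁻¹ : SU2) : Matrix (Fin 2) (Fin 2) ℂ)) ≤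
      frobNorm ((a : Matrix (Fin 2) (Fin 2) ℂ) - (c : Matrix (Fin 2) (Fin 2) ℂ)) +
        frobNorm ((b : Matrix (Fin 2) (Fin 2) ℂ) - (c : Matrix (Fin 2) (Fin 2) ℂ)) := by
  have h1 : frobNorm (((a * U * b⁻¹ : SU2) : Matrix (Fin 2) (Fin 2) ℂ) - ((c * U * b⁻¹ : SU2) : Matrix (Fin 2) (Fin 2) ℂ)) =
      frobNorm ((a : Matrix (Fin 2) (Fin 2) ℂ) - (c : Matrix (Fin 2) (Fin 2) ℂ)) := by
    have e : ((a * U * b⁻¹ : SU2) : Matrix (Fin 2) (Fin 2) ℂ) - ((c * U * b⁻¹ : SU2) : Matrix (Fin 2) (Fin 2) ℂ) =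
        ((a : Matrix (Fin 2) (Fin 2) ℂ) - (c : Matrix (Fin 2) (Fin 2) ℂ)) * ((U * b⁻¹ : SU2) : Matrix (Fin 2) (Fin 2) ℂ) := by
      rw [Matrix.sub_mul, ← Submonoid.coe_mul, ← Submonoid.coe_mul, mul_assoc, mul_assoc]
    rw [e, frobNorm_mul_unitary _ (su2_mem_unitaryGroup _)]
  have h2 : frobNorm (((c * U * b⁻¹ : SU2) : Matrix (Fin 2) (Fin 2) ℂ) - ((c * U * c⁻¹ : SU2) : Matrix (Fin 2) (Fin 2) ℂ)) =
      frobNorm ((b : Matrix (Fin 2) (Fin 2) ℂ) - (c : Matrix (Fin 2) (Fin 2) ℂ)) := by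
    have e : ((c * U * b⁻¹ : SU2) : Matrix (Fin 2) (Fin 2) ℂ) - ((c * U * c⁻¹ : SU2) : Matrix (Fin 2) (Fin 2) ℂ) =
        ((c * U : SU2) : Matrix (Fin 2) (Fin 2) ℂ) * (((b⁻¹ : SU2) : Matrix (Fin 2) (Fin 2) ℂ) - ((c⁻¹ : SU2) : Matrix (Fin 2) (Fin 2) ℂ)) := by
      rw [Matrix.mul_sub, ← Submonoid.coe_mul, ← Submonoid.coe_mul]
    rw [e, frobNorm_unitary_mul (su2_mem_unitaryGroup _), frobNorm_sub_eq_mul_inv, inv_inv, frobNorm_inv_mul_sub_one,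
      frobNorm_sub_comm]
  calc frobNorm (((a * U * b⁻¹ : SU2) : Matrix (Fin 2) (Fin 2) ℂ) - ((c * U * c⁻¹ : SU2) : Matrix (Fin 2) (Fin 2) ℂ))
      ≤ frobNorm (((a * U * b⁻¹ : SU2) : Matrix (Fin 2) (Fin 2) ℂ) - ((c * U * b⁻¹ : SU2) : Matrix (Fin 2) (Fin 2) ℂ)) +
          frobNorm (((c * U * b⁻¹ : SU2) : Matrix (Fin 2) (Fin 2) ℂ) - ((c * U * c⁻¹ : SU2) : Matrix (Fin 2) (Fin 2) ℂ)) :=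
        frobNorm_sub_le _ _ _
    _ = _ := by rw [h1, h2]

/-! ## §1 The three-dimensional toron box forces small plaquettes and a small Wilson action -/

omit [NeZero L] in
/-- Shifting in direction `ν` does not change the coordinate `μ ≠ ν`. [folklore] -/
theorem shift_apply_of_ne₃ (x : Site 3 L) {μ ν : Fin 3} (h : μ ≠ ν) : x.shift ν μ = x μ := by
  simp [Site.shift, Pi.single_eq_of_ne h]

omit [NeZero L] in
/-- ★ **Plaquettes in the toron box (d = 3).**  Let `C : Fin 3 → SU(2)` be seam letters `t₁`-close to `1` and suppose every link `V(x, μ)` is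
`t₂`-close to its letter — `C μ` if the link crosses the seam `x_μ = −1`, `1` otherwise (`‖letter⁻¹·V(x,μ) − 1‖_F ≤ t₂`).  Then every plaquette
holonomy is `(4t₂ + 2t₁²)`-close to `1`: the two `μ`-links of a `(μ,ν)`-plaquette cross the `μ`-seam together, so the plaquette is the word
`(Cᵢa)(Cⱼb)(Cᵢa')⁻¹(Cⱼb')⁻¹` of ✓`norm_rho_plaquetteWord_sub_one_le`. [cite: Luscher1983, §2] [cite: Balaban1985Averaging, (19) p.21] -/
theorem frobNorm_plaquetteHolonomy_sub_one_le_of_toronBox (V : GaugeConfig 3 L SU2) (C : Fin 3 → SU2) {t₁ t₂ : ℝ}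
    (ht₁ : 0 ≤ t₁) (hC : ∀ μ, frobNorm ((C μ : Matrix (Fin 2) (Fin 2) ℂ) - 1) ≤ t₁)
    (hV : ∀ e : Edge 3 L, frobNorm ((((if e.1 e.2 = -1 then C e.2 else 1)⁻¹ * V e : SU2) : Matrix (Fin 2) (Fin 2) ℂ) - 1) ≤ t₂)
    (x : Site 3 L) {i j : Fin 3} (hij : i ≠ j) :
    frobNorm (((plaquetteHolonomy V x i j : SU2) : Matrix (Fin 2) (Fin 2) ℂ) - 1) ≤ 4 * t₂ + 2 * t₁ ^ 2 := by
  set Cf : Edge 3 L → SU2 := fun e => if e.1 e.2 = -1 then C e.2 else 1 with hCf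
  have hCf1 : ∀ e, ‖su2Rep (Cf e) - 1‖ ≤ t₁ := by
    intro e
    simp only [hCf]
    split_ifs
    · rw [norm_su2Rep_sub_one]; exact hC _
    · rw [map_one, sub_self, norm_zero]; exact ht₁
  have hV' : ∀ e : Edge 3 L, ‖su2Rep ((Cf e)⁻¹ * V e) - 1‖ ≤ t₂ := fun e => by rw [norm_su2Rep_sub_one]; exact hV e
  have hshift_i : Cf (x.shift j, i) = Cf (x, i) := by simp only [hCf, shift_apply_of_ne₃ x hij]
  have hshift_j : Cf (x.shift i, j) = Cf (x, j) := by simp only [hCf, shift_apply_of_ne₃ x hij.symm]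
  have hsplit : ∀ e, V e = Cf e * ((Cf e)⁻¹ * V e) := fun e => (mul_inv_cancel_left _ _).symm
  rw [← norm_su2Rep_sub_one]
  unfold plaquetteHolonomy
  rw [hsplit (x, i), hsplit (x.shift i, j), hsplit (x.shift j, i), hsplit (x, j), hshift_i, hshift_j]
  refine (norm_rho_plaquetteWord_sub_one_le su2Rep su2_mem_unitaryGroup _ _ _ _ _ _).trans ?_
  have h1 := hV' (x, i)
  have h2 := hV' (x.shift i, j)
  have h3 := hV' (x.shift j, i)
  have h4 := hV' (x, j)
  rw [hshift_j] at h2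
  rw [hshift_i] at h3
  have hc : ‖su2Rep (Cf (x, i)) - 1‖ * ‖su2Rep (Cf (x, j)) - 1‖ ≤ t₁ * t₁ :=
    mul_le_mul (hCf1 (x, i)) (hCf1 (x, j)) (norm_nonneg _) ht₁
  have hsq : t₁ ^ 2 = t₁ * t₁ := sq t₁
  linarith [h1, h2, h3, h4, hc]

/-- ★ **The toron box forces a small spatial Wilson action**: under the hypotheses of `frobNorm_plaquetteHolonomy_sub_one_le_of_toronBox`,
`S(V) ≤ 3L³ · (4t₂ + 2t₁²)²/2` (`2 − Re tr W = ‖W − 1‖²_F/2`, `#P = 3L³`). [cite: Luscher1983, §2] -/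
theorem wilsonAction_le_of_toronBox (V : GaugeConfig 3 L SU2) (C : Fin 3 → SU2) {t₁ t₂ : ℝ}
    (ht₁ : 0 ≤ t₁) (hC : ∀ μ, frobNorm ((C μ : Matrix (Fin 2) (Fin 2) ℂ) - 1) ≤ t₁)
    (hV : ∀ e : Edge 3 L, frobNorm ((((if e.1 e.2 = -1 then C e.2 else 1)⁻¹ * V e : SU2) : Matrix (Fin 2) (Fin 2) ℂ) - 1) ≤ t₂) :
    wilsonAction su2Rep V ≤ 3 * (L : ℝ) ^ 3 * ((4 * t₂ + 2 * t₁ ^ 2) ^ 2 / 2) := by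
  unfold wilsonAction
  calc ∑ p : Plaquette 3 L, (((2 : ℕ) : ℝ) - (su2Rep (plaquetteHolonomy V p.1 p.2.1.1 p.2.1.2)).trace.re)
      ≤ ∑ _p : Plaquette 3 L, (4 * t₂ + 2 * t₁ ^ 2) ^ 2 / 2 := Finset.sum_le_sum fun p _ =>
        sub_re_trace_le su2Rep su2_mem_unitaryGroup _ (by
          rw [norm_su2Rep_sub_one]
          exact frobNorm_plaquetteHolonomy_sub_one_le_of_toronBox V C ht₁ hC hV p.1 (ne_of_lt p.2.2))
    _ = 3 * (L : ℝ) ^ 3 * ((4 * t₂ + 2 * t₁ ^ 2) ^ 2 / 2) := by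
        rw [Finset.sum_const, Finset.card_univ, FemtoTransferGap.card_plaquette_three L, nsmul_eq_mul]
        push_cast; ring

/-! ## §2 Kinetic bonds and the seam bond on the box -/

/-- The kinetic bond deficit `6L³ − timeCoupling(U,V)` is at most `3L³·s²/2` when corresponding links are within Frobenius distance `s`
(`2 − Re tr(U_eV_e⁻¹) = ‖U_e − V_e‖²_F/2`). [cite: MontvayMunster1994, §3.2.3 (3.97)] -/
theorem kinetic_le_of_dist {s : ℝ} {U V : GaugeConfig 3 L SU2} (hs : 0 ≤ s)
    (h : ∀ e, frobNorm ((U e : Matrix (Fin 2) (Fin 2) ℂ) - (V e : Matrix (Fin 2) (Fin 2) ℂ)) ≤ s) :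
    6 * (L : ℝ) ^ 3 - timeCoupling su2Rep U V ≤ 3 * (L : ℝ) ^ 3 * (s ^ 2 / 2) := by
  have hterm : ∀ e : Edge 3 L, 2 - ((su2Rep (U e * (V e)⁻¹)).trace).re ≤ s ^ 2 / 2 := fun e => by
    rw [fundamentalRep_apply, two_sub_re_trace_eq, ← frobNorm_sub_eq_mul_inv]
    have h0 := frobNorm_nonneg ((U e : Matrix (Fin 2) (Fin 2) ℂ) - (V e : Matrix (Fin 2) (Fin 2) ℂ))
    have hsq := mul_le_mul (h e) (h e) h0 hs
    nlinarith
  have hsum : 6 * (L : ℝ) ^ 3 - timeCoupling su2Rep U V = ∑ e : Edge 3 L, (2 - ((su2Rep (U e * (V e)⁻¹)).trace).re) := by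
    unfold timeCoupling
    rw [Finset.sum_sub_distrib, Finset.sum_const, Finset.card_univ, FemtoTransferGap.card_edge_three L, nsmul_eq_mul]
    push_cast; ring
  rw [hsum]
  calc ∑ e : Edge 3 L, (2 - ((su2Rep (U e * (V e)⁻¹)).trace).re)
      ≤ ∑ _e : Edge 3 L, s ^ 2 / 2 := Finset.sum_le_sum fun e _ => hterm e
    _ = 3 * (L : ℝ) ^ 3 * (s ^ 2 / 2) := by
        rw [Finset.sum_const, Finset.card_univ, FemtoTransferGap.card_edge_three L, nsmul_eq_mul]
        push_cast; ring

omit [NeZero L] in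
/-- **The seam gauge transformation on the box moves slice `0` by at most `2t₂ + 2t₁(t₁ + u)` per link**: if `g 0` is `t₁`-close to `1`, every
`g x` is `t₂`-close to `g 0`, and the link `U e` is `u`-close to `1`, then `‖(g·U) e − U e‖_F ≤ 2t₂ + 2t₁u`. [cite: Luscher1983, §2] -/
theorem frobNorm_gaugeTransform_sub_le_of_seamBox {t₁ t₂ u : ℝ} {g : Site 3 L → SU2} {U : GaugeConfig 3 L SU2}
    (hg0 : frobNorm ((g 0 : Matrix (Fin 2) (Fin 2) ℂ) - 1) ≤ t₁)
    (hg : ∀ x, frobNorm ((((g 0)⁻¹ * g x : SU2) : Matrix (Fin 2) (Fin 2) ℂ) - 1) ≤ t₂) (e : Edge 3 L)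
    (hU : frobNorm ((U e : Matrix (Fin 2) (Fin 2) ℂ) - 1) ≤ u) :
    frobNorm (((gaugeTransform g U e : SU2) : Matrix (Fin 2) (Fin 2) ℂ) - (U e : Matrix (Fin 2) (Fin 2) ℂ)) ≤
      2 * t₂ + 2 * (t₁ * u) := by
  have hgx : ∀ x, frobNorm ((g x : Matrix (Fin 2) (Fin 2) ℂ) - (g 0 : Matrix (Fin 2) (Fin 2) ℂ)) ≤ t₂ := fun x => by
    rw [← frobNorm_inv_mul_sub_one]; exact hg x
  have h1 := frobNorm_sandwich_sub_sandwich_le (g e.1) (g (e.1.shift e.2)) (g 0) (U e)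
  have h2 := frobNorm_conj_sub_le (g 0) (U e)
  have h3 : frobNorm ((g 0 : Matrix (Fin 2) (Fin 2) ℂ) - 1) * frobNorm ((U e : Matrix (Fin 2) (Fin 2) ℂ) - 1) ≤ t₁ * u :=
    mul_le_mul hg0 hU (frobNorm_nonneg _) ((frobNorm_nonneg _).trans hg0)
  calc frobNorm (((gaugeTransform g U e : SU2) : Matrix (Fin 2) (Fin 2) ℂ) - (U e : Matrix (Fin 2) (Fin 2) ℂ))
      ≤ frobNorm (((g e.1 * U e * (g (e.1.shift e.2))⁻¹ : SU2) : Matrix (Fin 2) (Fin 2) ℂ) -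
            ((g 0 * U e * (g 0)⁻¹ : SU2) : Matrix (Fin 2) (Fin 2) ℂ)) +
          frobNorm (((g 0 * U e * (g 0)⁻¹ : SU2) : Matrix (Fin 2) (Fin 2) ℂ) - (U e : Matrix (Fin 2) (Fin 2) ℂ)) :=
        frobNorm_sub_le _ _ _
    _ ≤ (t₂ + t₂) + 2 * (t₁ * u) := add_le_add (h1.trans (add_le_add (hgx _) (hgx _))) (h2.trans (by linarith))
    _ = 2 * t₂ + 2 * (t₁ * u) := by ring

/-! ## §3 The ring deficit on the toron box -/

omit [NeZero L] in
/-- A tree link does not cross the seam of its own direction. [folklore] -/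
theorem apply_ne_neg_one_of_treeEdge {e : Edge 3 L} (h : treeEdge e = true) : e.1 e.2 ≠ -1 := by
  rw [treeEdge_iff] at h
  rcases h with ⟨h2, hx⟩ | ⟨h1, -, hx⟩ | ⟨h0, -, -, hx⟩
  · rw [h2]; exact hx
  · rw [h1]; exact hx
  · rw [h0]; exact hx

omit [NeZero L] in
/-- The leader wrap link `(−ê_μ, μ)` is off the slice-`0` tree. [folklore] -/
theorem leader_not_treeEdge (μ : Fin 3) : ¬ treeEdge ((Pi.single μ (-1 : ZMod L), μ) : Edge 3 L) = true := fun h =>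
  apply_ne_neg_one_of_treeEdge h (by simp)

/-- ★★ **THE RING DEFICIT IS `≤ 400·L⁴·t₂²` ON THE TORON BOX.**  Tree-gauge coordinates `(w, (r, g))`, ring history `(glue w ∷ r, g)`; leaders
`C μ = w(−ê_μ, μ)`; hypotheses: (leaders) `‖C μ − 1‖_F ≤ t₁`, `‖g 0 − 1‖_F ≤ t₁`; (slice `0`) every off-tree link `t₂`-close to its letter,
`‖letter⁻¹·w_i − 1‖_F ≤ t₂`; (slices `1…2L−1`) `‖(glue w e)⁻¹·r_j e − 1‖_F ≤ t₂`; (seam) `‖(g 0)⁻¹ g x − 1‖_F ≤ t₂`; radii `0 ≤ t₁ ≤ 1`,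
`0 ≤ t₂`, `t₁² ≤ t₂`.  Bookkeeping through ✓`ringDeficit_eq_sums`: `2L − 1` kinetic bonds `≤ 6L³t₂²` (consecutive slices `2t₂`-close),
the seam bond `≤ 3L³(7t₂)²/2` (`frobNorm_gaugeTransform_sub_le_of_seamBox`), `2L` Wilson actions `≤ 150L³t₂²` (every slice is in the toron box of
§1 with radii `(t₁, 2t₂)`). [cite: Luscher1983, §2] [cite: Vanbaal2001] -/
theorem ringDeficit_le_of_toronBox {t₁ t₂ : ℝ} (ht₁ : 0 ≤ t₁) (ht₁1 : t₁ ≤ 1) (ht₂ : 0 ≤ t₂) (h12 : t₁ ^ 2 ≤ t₂)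
    (w : OffIdx L → SU2) (r : Fin (2 * L - 1) → GaugeConfig 3 L SU2) (g : Site 3 L → SU2)
    (hlead : ∀ μ : Fin 3, frobNorm ((w ⟨(Pi.single μ (-1 : ZMod L), μ), leader_not_treeEdge μ⟩ : Matrix (Fin 2) (Fin 2) ℂ) - 1) ≤ t₁)
    (hw : ∀ i : OffIdx L, frobNorm ((((if i.1.1 i.1.2 = -1 then w ⟨(Pi.single i.1.2 (-1 : ZMod L), i.1.2), leader_not_treeEdge i.1.2⟩
        else 1)⁻¹ * w i : SU2) : Matrix (Fin 2) (Fin 2) ℂ) - 1) ≤ t₂)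
    (hr : ∀ (j : Fin (2 * L - 1)) (e : Edge 3 L), frobNorm ((((glue w e)⁻¹ * r j e : SU2) : Matrix (Fin 2) (Fin 2) ℂ) - 1) ≤ t₂)
    (hg0 : frobNorm ((g 0 : Matrix (Fin 2) (Fin 2) ℂ) - 1) ≤ t₁)
    (hg : ∀ x, frobNorm ((((g 0)⁻¹ * g x : SU2) : Matrix (Fin 2) (Fin 2) ℂ) - 1) ≤ t₂) :
    ringDeficit L (fun _ => false) ((Fin.cons (glue w) r : Fin (2 * L - 1 + 1) → GaugeConfig 3 L SU2), g) ≤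
      400 * (L : ℝ) ^ 4 * t₂ ^ 2 := by
  -- abbreviations
  set C : Fin 3 → SU2 := fun μ => w ⟨(Pi.single μ (-1 : ZMod L), μ), leader_not_treeEdge μ⟩ with hCdef
  set ℓ : Edge 3 L → SU2 := fun e => if e.1 e.2 = -1 then C e.2 else 1 with hℓ
  set P : Fin (2 * L - 1 + 1) → GaugeConfig 3 L SU2 := Fin.cons (glue w) r with hP
  have hL1 : (1 : ℝ) ≤ L := by exact_mod_cast NeZero.one_le
  have hL0 : (0 : ℝ) ≤ (L : ℝ) ^ 3 := by positivity
  have ht12 : t₁ * t₂ ≤ t₂ := by nlinarith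
  have hC : ∀ μ, frobNorm ((C μ : Matrix (Fin 2) (Fin 2) ℂ) - 1) ≤ t₁ := hlead
  -- letters are `t₁`-close to `1`
  have hℓ1 : ∀ e, frobNorm ((ℓ e : Matrix (Fin 2) (Fin 2) ℂ) - 1) ≤ t₁ := by
    intro e; simp only [hℓ]
    split_ifs
    · exact hC _
    · simp [frobNorm_zero, ht₁]
  -- slice 0 is `t₂`-close to the letters, linkwise
  have h0ℓ : ∀ e : Edge 3 L, frobNorm (((glue w e : SU2) : Matrix (Fin 2) (Fin 2) ℂ) - (ℓ e : Matrix (Fin 2) (Fin 2) ℂ)) ≤ t₂ := by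
    intro e
    by_cases he : treeEdge e = true
    · have hne := apply_ne_neg_one_of_treeEdge he
      rw [glue_apply_of_tree w he]
      simp only [hℓ, if_neg hne, sub_self, frobNorm_zero]
      exact ht₂
    · rw [glue_apply_of_not_tree w he, ← frobNorm_inv_mul_sub_one]
      exact hw ⟨e, he⟩
  -- hence slice 0 is `(t₁ + t₂)`-close to `1`
  have h01 : ∀ e : Edge 3 L, frobNorm (((glue w e : SU2) : Matrix (Fin 2) (Fin 2) ℂ) - 1) ≤ t₂ + t₁ := fun e =>
    (frobNorm_sub_le _ _ _).trans (add_le_add (h0ℓ e) (hℓ1 e))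
  -- every slice is `t₂`-close to slice 0
  have hP0 : ∀ (i : Fin (2 * L - 1 + 1)) (e : Edge 3 L),
      frobNorm ((P i e : Matrix (Fin 2) (Fin 2) ℂ) - ((glue w e : SU2) : Matrix (Fin 2) (Fin 2) ℂ)) ≤ t₂ := by
    intro i e
    refine Fin.cases ?_ (fun j => ?_) i
    · simp only [hP, Fin.cons_zero, sub_self, frobNorm_zero]; exact ht₂
    · simp only [hP, Fin.cons_succ]
      rw [← frobNorm_inv_mul_sub_one]; exact hr j e
  -- every slice is in the toron box of radii `(t₁, 2t₂)`
  have hPℓ : ∀ (i : Fin (2 * L - 1 + 1)) (e : Edge 3 L),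
      frobNorm ((((ℓ e)⁻¹ * P i e : SU2) : Matrix (Fin 2) (Fin 2) ℂ) - 1) ≤ 2 * t₂ := by
    intro i e
    rw [frobNorm_inv_mul_sub_one]
    exact (frobNorm_sub_le _ _ _).trans (by linarith [hP0 i e, h0ℓ e])
  have hS : ∀ i : Fin (2 * L - 1 + 1), wilsonAction su2Rep (P i) ≤ 150 * (L : ℝ) ^ 3 * t₂ ^ 2 := by
    intro i
    have h := wilsonAction_le_of_toronBox (P i) C ht₁ hC (t₂ := 2 * t₂) (fun e => hPℓ i e)
    have hb : (4 * (2 * t₂) + 2 * t₁ ^ 2) ^ 2 / 2 ≤ 50 * t₂ ^ 2 := by nlinarith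
    nlinarith [hb]
  have hSg : wilsonAction su2Rep (gaugeTransform g (P 0)) ≤ 150 * (L : ℝ) ^ 3 * t₂ ^ 2 := by
    rw [wilsonAction_gaugeTransform]; exact hS 0
  -- kinetic bonds
  have hkin : ∀ i : Fin (2 * L - 1),
      6 * (L : ℝ) ^ 3 - timeCoupling su2Rep (P i.castSucc) (P i.succ) ≤ 6 * (L : ℝ) ^ 3 * t₂ ^ 2 := by
    intro i
    have hd : ∀ e, frobNorm ((P i.castSucc e : Matrix (Fin 2) (Fin 2) ℂ) - (P i.succ e : Matrix (Fin 2) (Fin 2) ℂ)) ≤ 2 * t₂ :=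
      fun e => (frobNorm_sub_le _ ((glue w e : SU2) : Matrix (Fin 2) (Fin 2) ℂ) _).trans (by
        rw [frobNorm_sub_comm ((glue w e : SU2) : Matrix (Fin 2) (Fin 2) ℂ)]
        linarith [hP0 i.castSucc e, hP0 i.succ e])
    have h := kinetic_le_of_dist (by positivity) hd
    nlinarith [h]
  -- seam bond
  have hseam : 6 * (L : ℝ) ^ 3 - timeCoupling su2Rep (P (Fin.last (2 * L - 1))) (gaugeTransform g (P 0)) ≤
      3 * (L : ℝ) ^ 3 * ((7 * t₂) ^ 2 / 2) := by
    have hP00 : P 0 = glue w := by simp only [hP, Fin.cons_zero]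
    have hd : ∀ e, frobNorm ((P (Fin.last (2 * L - 1)) e : Matrix (Fin 2) (Fin 2) ℂ) -
        ((gaugeTransform g (P 0) e : SU2) : Matrix (Fin 2) (Fin 2) ℂ)) ≤ 7 * t₂ := by
      intro e
      rw [hP00]
      have h1 := hP0 (Fin.last (2 * L - 1)) e
      have h2 := frobNorm_gaugeTransform_sub_le_of_seamBox hg0 hg e (h01 e)
      rw [frobNorm_sub_comm] at h2
      have h3 := frobNorm_sub_le (P (Fin.last (2 * L - 1)) e : Matrix (Fin 2) (Fin 2) ℂ)
        ((glue w e : SU2) : Matrix (Fin 2) (Fin 2) ℂ) ((gaugeTransform g (glue w) e : SU2) : Matrix (Fin 2) (Fin 2) ℂ)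
      nlinarith [h1, h2, h3, ht12, h12]
    exact kinetic_le_of_dist (by positivity) hd
  -- assemble through `ringDeficit_eq_sums`
  rw [ringDeficit_eq_sums, twist3_false]
  dsimp only
  have hcast : ((2 * L - 1 : ℕ) : ℝ) = 2 * (L : ℝ) - 1 := by
    have : 1 ≤ L := NeZero.one_le
    rw [Nat.cast_sub (by omega), Nat.cast_mul]; norm_num
  have hA : ∑ i : Fin (2 * L - 1), (6 * (L : ℝ) ^ 3 - timeCoupling su2Rep (P i.castSucc) (P i.succ)) ≤
      (2 * (L : ℝ) - 1) * (6 * (L : ℝ) ^ 3 * t₂ ^ 2) := by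
    calc ∑ i : Fin (2 * L - 1), (6 * (L : ℝ) ^ 3 - timeCoupling su2Rep (P i.castSucc) (P i.succ))
        ≤ ∑ _i : Fin (2 * L - 1), 6 * (L : ℝ) ^ 3 * t₂ ^ 2 := Finset.sum_le_sum fun i _ => hkin i
      _ = (2 * (L : ℝ) - 1) * (6 * (L : ℝ) ^ 3 * t₂ ^ 2) := by
          rw [Finset.sum_const, Finset.card_univ, Fintype.card_fin, nsmul_eq_mul, hcast]
  have hB : ∑ i : Fin (2 * L - 1), (1 / 2 : ℝ) * (wilsonAction su2Rep (P i.castSucc) + wilsonAction su2Rep (P i.succ)) ≤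
      (2 * (L : ℝ) - 1) * (150 * (L : ℝ) ^ 3 * t₂ ^ 2) := by
    calc ∑ i : Fin (2 * L - 1), (1 / 2 : ℝ) * (wilsonAction su2Rep (P i.castSucc) + wilsonAction su2Rep (P i.succ))
        ≤ ∑ _i : Fin (2 * L - 1), 150 * (L : ℝ) ^ 3 * t₂ ^ 2 :=
          Finset.sum_le_sum fun i _ => by linarith [hS i.castSucc, hS i.succ]
      _ = (2 * (L : ℝ) - 1) * (150 * (L : ℝ) ^ 3 * t₂ ^ 2) := by
          rw [Finset.sum_const, Finset.card_univ, Fintype.card_fin, nsmul_eq_mul, hcast]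
  have hD : (1 / 2 : ℝ) * (wilsonAction su2Rep (P (Fin.last (2 * L - 1))) + wilsonAction su2Rep (gaugeTransform g (P 0))) ≤
      150 * (L : ℝ) ^ 3 * t₂ ^ 2 := by linarith [hS (Fin.last (2 * L - 1)), hSg]
  have ht0 : 0 ≤ t₂ ^ 2 := sq_nonneg _
  have hmono : (L : ℝ) ^ 3 * t₂ ^ 2 ≤ (L : ℝ) ^ 4 * t₂ ^ 2 := by
    have h := mul_nonneg (mul_nonneg hL0 (sub_nonneg.2 hL1)) ht0
    nlinarith [h]
  nlinarith [hA, hB, hD, hseam, hmono, mul_nonneg hL0 ht0]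

end Summit.QuantumFields.YangMills.Theorems.SwapTwistDeficit.PeriodicRingFloor

end
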